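import Literature.NumberTheory.Sieve.GoldstonPintzYildirimThetaDirichlet
import Literature.NumberTheory.Sieve.GoldstonPintzYildirimThetaEulerBound
import Literature.NumberTheory.Sieve.GoldstonPintzYildirimShift
import HarnessLib

/-!
# Goldston–Pintz–Yıldırım, *Primes in tuples I*, §9: the integrand of (9.15) in the form (8.1)–(8.2)

Trunk: NumberTheory / Sieve. GPY, *Primes in tuples. I* (Ann. of Math. 170 (2009) =
arXiv:math/0508185): after (9.19) the double integral (9.15) for `𝒯̃_R` is brought to the shape
(8.1)–(8.2) of Lemma 3 — with `W(s) = s ζ(1+s)` ((7.14); Mathlib's `riemannZeta₁ (1 + s)`),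
`F(s₁,s₂) R^{s₁}s₁^{−(k₁+ℓ₁+1)} R^{s₂}s₂^{−(k₂+ℓ₂+1)} = D(s₁,s₂) R^{s₁+s₂}/(s₁^{u+1}s₂^{v+1}(s₁+s₂)^d)`,
`D = G W(s₁+s₂)^d/(W(s₁)^a W(s₂)^b)`, `u = k₁ + ℓ₁ − a`, `v = k₂ + ℓ₂ − b` ("in Case 1 `a = k₁, b = k₂,
d = r, u = ℓ₁, v = ℓ₂`; in Case 2 …; in Case 3 …", last paragraph of §9). This file PROVES that
pointwise identity on the lines `Re s₁ = Re s₂ = 1` (theorems only):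

* `riemannZeta_one_add_eq_div` — `ζ(1+s) = W(s)/s` for `s ≠ 0`;
* `FDir₂Star_mul_perronPow_eq_lemma3Form` — the identity above, for any exponents `(a, b, d)` and
  `u, v` with `K₁ = u + a`, `K₂ = v + b`, stated with `GStar h₀ H₁ H₂ a b d`.

## References

* D. A. Goldston, J. Pintz, C. Y. Yıldırım, *Primes in tuples. I*, Ann. of Math. (2) 170 (2009),
  819–862 = arXiv:math/0508185, §7 (7.14)–(7.15), §8 (8.1)–(8.2), §9 after (9.23).
  [cite: GoldstonPintzYildirim2009]
-/

noncomputable section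

open Finset Complex Literature.Analysis.Complex

namespace Literature.NumberTheory.Sieve.GPY

/-- `ζ(1 + s) = W(s)/s` with `W(s) = riemannZeta₁ (1 + s) = s ζ(1+s)` (`s ≠ 0`).
[cite: GoldstonPintzYildirim2009, Section 7 eq. 7.14] -/
theorem riemannZeta_one_add_eq_div {s : ℂ} (hs : s ≠ 0) :
    riemannZeta (1 + s) = riemannZeta₁ (1 + s) / s := by
  rw [riemannZeta₁_one_add hs, mul_div_cancel_left₀ _ hs]

/-- **The integrand of (9.15) in the form (8.1)–(8.2)**: on `Re s₁ = Re s₂ = 1`, for `R > 0`,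
`H₁`, `H₂` not both empty, any exponents `a, b, d` and `u, v` (`Kᵢ = kᵢ + ℓᵢ` written as
`u + a`, `v + b`):
`F(s₁,s₂) · R^{s₁}s₁^{−(u+a+1)} · R^{s₂}s₂^{−(v+b+1)}
   = [G(s₁,s₂) W(s₁+s₂)^d/(W(s₁)^a W(s₂)^b)] · R^{s₁+s₂}/(s₁^{u+1} s₂^{v+1} (s₁+s₂)^d)`
(`F = FDir₂Star`, `G = GStar h₀ H₁ H₂ a b d`, `W(s) = riemannZeta₁ (1+s)`; (9.17)–(9.19) and
`ζ(1+s) = W(s)/s`). [cite: GoldstonPintzYildirim2009, Section 8 eq. 8.1] -/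
theorem FDir₂Star_mul_perronPow_eq_lemma3Form {R : ℝ} (hR : 0 < R) (h₀ : ℕ) {H₁ H₂ : Finset ℕ}
    (hk : 1 ≤ H₁.card + H₂.card) (a b d u v : ℕ) (t₁ t₂ : ℝ) :
    FDir₂Star h₀ H₁ H₂ (((1 : ℝ) : ℂ) + t₁ * I) (((1 : ℝ) : ℂ) + t₂ * I) *
        perronPow R (u + a) (((1 : ℝ) : ℂ) + t₁ * I) * perronPow R (v + b) (((1 : ℝ) : ℂ) + t₂ * I) =
      (GStar h₀ H₁ H₂ a b d (((1 : ℝ) : ℂ) + t₁ * I) (((1 : ℝ) : ℂ) + t₂ * I) *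
          riemannZeta₁ (1 + ((((1 : ℝ) : ℂ) + t₁ * I) + (((1 : ℝ) : ℂ) + t₂ * I))) ^ d /
          (riemannZeta₁ (1 + (((1 : ℝ) : ℂ) + t₁ * I)) ^ a *
            riemannZeta₁ (1 + (((1 : ℝ) : ℂ) + t₂ * I)) ^ b)) *
        ((R : ℂ) ^ ((((1 : ℝ) : ℂ) + t₁ * I) + (((1 : ℝ) : ℂ) + t₂ * I)) /
          ((((1 : ℝ) : ℂ) + t₁ * I) ^ (u + 1) * (((1 : ℝ) : ℂ) + t₂ * I) ^ (v + 1) *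
            ((((1 : ℝ) : ℂ) + t₁ * I) + (((1 : ℝ) : ℂ) + t₂ * I)) ^ d)) := by
  set s₁ : ℂ := ((1 : ℝ) : ℂ) + t₁ * I with hs₁def
  set s₂ : ℂ := ((1 : ℝ) : ℂ) + t₂ * I with hs₂def
  have hre₁ : s₁.re = 1 := by simp [hs₁def]
  have hre₂ : s₂.re = 1 := by simp [hs₂def]
  have hs₁ : s₁ ≠ 0 := fun h => by have := congrArg Complex.re h; rw [hre₁] at this; simp at this
  have hs₂ : s₂ ≠ 0 := fun h => by have := congrArg Complex.re h; rw [hre₂] at this; simp at this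
  have hs₁₂ : s₁ + s₂ ≠ 0 := fun h => by
    have := congrArg Complex.re h
    simp only [Complex.add_re, hre₁, hre₂, Complex.zero_re] at this
    norm_num at this
  have hζ₁ : riemannZeta (1 + s₁) ≠ 0 := riemannZeta_one_add_ne_zero (by rw [hre₁]; norm_num)
  have hζ₂ : riemannZeta (1 + s₂) ≠ 0 := riemannZeta_one_add_ne_zero (by rw [hre₂]; norm_num)
  have hζ₁₂ : riemannZeta (1 + (s₁ + s₂)) ≠ 0 :=
    riemannZeta_one_add_ne_zero (by simp only [Complex.add_re, hre₁, hre₂]; norm_num)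
  have hW₁ : riemannZeta₁ (1 + s₁) ≠ 0 := by rw [riemannZeta₁_one_add hs₁]; exact mul_ne_zero hs₁ hζ₁
  have hW₂ : riemannZeta₁ (1 + s₂) ≠ 0 := by rw [riemannZeta₁_one_add hs₂]; exact mul_ne_zero hs₂ hζ₂
  have hW₁₂ : riemannZeta₁ (1 + (s₁ + s₂)) ≠ 0 := by
    rw [riemannZeta₁_one_add hs₁₂]; exact mul_ne_zero hs₁₂ hζ₁₂
  have hR0 : (R : ℂ) ≠ 0 := by exact_mod_cast hR.ne'
  rw [FDir₂Star_eq_GStar_mul h₀ H₁ H₂ hk a b d (by rw [hre₁]) (by rw [hre₂]),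
    show (1 : ℂ) + s₁ + s₂ = 1 + (s₁ + s₂) by ring,
    riemannZeta_one_add_eq_div hs₁, riemannZeta_one_add_eq_div hs₂, riemannZeta_one_add_eq_div hs₁₂,
    div_pow, div_pow, div_pow]
  unfold perronPow
  rw [show (R : ℂ) ^ (s₁ + s₂) = (R : ℂ) ^ s₁ * (R : ℂ) ^ s₂ from Complex.cpow_add _ _ hR0]
  have hs₁p : s₁ ^ (u + 1) ≠ 0 := pow_ne_zero _ hs₁
  have hs₂p : s₂ ^ (v + 1) ≠ 0 := pow_ne_zero _ hs₂
  have hs₁a : s₁ ^ a ≠ 0 := pow_ne_zero _ hs₁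
  have hs₂b : s₂ ^ b ≠ 0 := pow_ne_zero _ hs₂
  have hs₁₂d : (s₁ + s₂) ^ d ≠ 0 := pow_ne_zero _ hs₁₂
  have hW₁a : riemannZeta₁ (1 + s₁) ^ a ≠ 0 := pow_ne_zero _ hW₁
  have hW₂b : riemannZeta₁ (1 + s₂) ^ b ≠ 0 := pow_ne_zero _ hW₂
  have hs₁K : s₁ ^ (u + a + 1) ≠ 0 := pow_ne_zero _ hs₁
  have hs₂K : s₂ ^ (v + b + 1) ≠ 0 := pow_ne_zero _ hs₂
  field_simp
  ring

/-! ### Symmetry `(H₁, ℓ₁, s₁) ↔ (H₂, ℓ₂, s₂)` (to reduce the case `H₁ = ∅` to `H₂ = ∅`) -/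

/-- `nuJointStar` is symmetric: `nuJointStar h₀ H₁ H₂ d e = nuJointStar h₀ H₂ H₁ e d`. [folklore] -/
theorem nuJointStar_comm (h₀ : ℕ) (H₁ H₂ : Finset ℕ) (d e : ℕ) :
    nuJointStar h₀ H₁ H₂ d e = nuJointStar h₀ H₂ H₁ e d := by
  unfold nuJointStar
  rw [Nat.lcm_comm e d]
  refine Finset.prod_congr rfl fun p hp => ?_
  have hpp := Nat.prime_of_mem_primeFactors hp
  have hpde : p ∣ d ∨ p ∣ e :=
    hpp.dvd_mul.1 ((Nat.dvd_of_mem_primeFactors hp).trans (Nat.lcm_dvd_mul d e))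
  unfold nuJointStarPrime
  by_cases hd : p ∣ d <;> by_cases he : p ∣ e
  · simp [hd, he, nuBarStar_comm h₀ H₁ H₂ p]
  · simp [hd, he]
  · simp [hd, he]
  · exact absurd hpde (by tauto)

/-- `c*` is symmetric: `pairCoeffStar h₀ H₁ H₂ d e = pairCoeffStar h₀ H₂ H₁ e d`. [folklore] -/
theorem pairCoeffStar_comm (h₀ : ℕ) (H₁ H₂ : Finset ℕ) (d e : ℕ) :
    pairCoeffStar h₀ H₁ H₂ d e = pairCoeffStar h₀ H₂ H₁ e d := by
  unfold pairCoeffStar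
  rw [nuJointStar_comm, Nat.lcm_comm d e]
  ring

/-- **`𝒯̃_R` is symmetric**: `mainTRTheta R H₁ H₂ ℓ₁ ℓ₂ h₀ = mainTRTheta R H₂ H₁ ℓ₂ ℓ₁ h₀`
(swap `(d, e)` in the double sum). [cite: GoldstonPintzYildirim2009, Section 9 eq. 9.12] -/
theorem mainTRTheta_comm (R : ℝ) (H₁ H₂ : Finset ℕ) (ℓ₁ ℓ₂ h₀ : ℕ) :
    mainTRTheta R H₁ H₂ ℓ₁ ℓ₂ h₀ = mainTRTheta R H₂ H₁ ℓ₂ ℓ₁ h₀ := by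
  unfold mainTRTheta
  rw [mul_comm (((#H₁ + ℓ₁).factorial : ℝ)⁻¹)]
  congr 1
  rw [Finset.sum_product, Finset.sum_product, Finset.sum_comm]
  refine Finset.sum_congr rfl fun e _ => Finset.sum_congr rfl fun d _ => ?_
  rw [nuJointStar_comm h₀ H₁ H₂ d e, Nat.lcm_comm d e]
  ring

/-- `F` is symmetric: `FDir₂Star h₀ H₁ H₂ s₁ s₂ = FDir₂Star h₀ H₂ H₁ s₂ s₁` (swap the summation
variables). [folklore] -/
theorem FDir₂Star_comm (h₀ : ℕ) (H₁ H₂ : Finset ℕ) (s₁ s₂ : ℂ) :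
    FDir₂Star h₀ H₁ H₂ s₁ s₂ = FDir₂Star h₀ H₂ H₁ s₂ s₁ := by
  unfold FDir₂Star
  rw [← (Equiv.prodComm ℕ ℕ).tsum_eq]
  refine tsum_congr fun p => ?_
  obtain ⟨d, e⟩ := p
  simp only [Equiv.prodComm_apply, Prod.swap_prod_mk, FDir₂StarTerm]
  rw [pairCoeffStar_comm h₀ H₁ H₂ e d, mul_comm ((e : ℂ) ^ s₁)]

end Literature.NumberTheory.Sieve.GPY
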